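import Mathlib
import Summits.QuantumFields.YangMills.Theorems.CoarseStiffnessTailCappedCoarseStiffnessLBareCompactCoupling
import Summits.QuantumFields.YangMills.Theorems.CoarseStiffnessTailCappedCoarseStiffnessLQuadraticTransfer
import Summits.QuantumFields.YangMills.Theorems.CoarseStiffnessTailCappedCoarseStiffnessLEdgeBoundedDepth
import Summits.QuantumFields.YangMills.Theses.CoarseStiffnessTail

/-!
# Route `CoarseStiffnessTail` — THE CRUX `CappedCoarseStiffnessL` HOLDS AT EVERY BOUNDED DEPTH ON EVERY COMPACT COUPLING RANGE, UNIFORMLY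
# IN THE CUT-OFF AND THE VOLUME (lead's certificate, seat `ym-line-cst-p1` g14; helper on 25301)

THE THEOREMS (three-torus families of [Balaban1985UV3], `SU(2)`, the crux's objects VERBATIM: `Gibbs_K`, the `j`-fold (0.4) average `Ū^j`,
`β_{K−j} = (γL^{−(K−j)})⁻¹`, `θ(K−j) = θBal F.L γ b₀ p₀ (K−j)`).
* §2 ★ `exists_coarseStiffness_le` — for every `L`, `j` there are `κ > 0`, `A ≥ 0` with, for all `F` (`F.L = L`), `0 < γ ≤ 1`, `K ≥ j`, `0 ≤ c₀ ≤ κ`: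
  `∫ exp(c₀·β_{K−j}·Σ_{a ∈ Plaq_j}|Ū^j(∂a) − 1|²) dGibbs_K ≤ exp(A·#Plaq_0 + (3/2)·(#Plaq_0/n_K)·log β_K)` — the UNCAPPED stiffness of the averaged
  field with total logarithmic slack (`#Plaq_0 = L^{3j}·#Plaq_j`, `card_plaq_zero_eq_pow_mul`).
* §3 ★★ `coarseStiffness_boundedDepth_compactCoupling` and, by pointwise domination, ★★★ `crux_boundedDepth_compactCoupling` /
  ★★★ `bulk_boundedDepth_compactCoupling`: for every `L`, `j₀`, `γ_lo > 0` there are `c₀ > 0`, `C₀` such that for EVERY `F` with `F.L = L`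
  (any `m`), every `γ ∈ [γ_lo, 1]`, every profile `(b₀, p₀)`, EVERY `K` and every `j ≤ min(j₀, K)`:
  `∫ exp(c₀·β_{K−j}·Σ_a min(|Ū^j(∂a) − 1|², θ(K−j)²)) dGibbs_K ≤ exp(C₀·#Plaq_j)` — i.e. `CappedCoarseStiffnessL` (stmt-QuantumFields-25301)
  with `j ≤ j₀` and `γ_lo ≤ γ` added, and the same for the registered BULK stub `stub_subThresholdStiffness` of skeleton v5.

PROOF.  The companion `…LQuadraticTransfer.sum_dist1_iter_sq_le` gives `Σ_a|Ū^j(∂a) − 1|² ≤ D_j²·3(2j+1)³·Σ_q|U(∂q) − 1|²` pointwise; with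
`β_K = L^j·β_{K−j}` (g13's `beta_eq_pow_mul`) the level-`j` exponent is `≤ (c₀D_j²·3(2j+1)³/L^j)·β_K·Σ_q|U(∂q) − 1|²`, and for `c₀ ≤ κ` the fine
coefficient is `≤ 1/8`, so `CoarseStiffnessTailBareCompactCoupling.exists_bareStiffness_le` (the N13 partition sandwich) integrates it.  On
`[γ_lo, 1]` the slack is `≤ (3/4)(1 + max(log γ_lo⁻¹, 0))·#Plaq_0` (`slack_le`) and `#Plaq_0 ≤ L^{3j₀}·#Plaq_j`; constants over `j ≤ j₀` by
`Finset.inf'`/`sup'`.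

WHAT IT SAYS (line card `Cruxes/CappedCoarseStiffnessL/Lines/birth.md` §g14; no claim about Bałaban's estimates).  Together with
`…LBareCompactCoupling` (the `j = 0` faces) and g13's `…LEdgeBoundedDepth` (EDGE at bounded depth, even γ-uniformly): EVERY BOUNDED-DEPTH,
COMPACT-COUPLING INSTANCE OF THE CRUX AND OF BOTH REGISTERED STUBS IS NOW A THEOREM OF THE TREE, uniformly in the cut-off `K` and the volume
`m`.  The located content of 25301 is exactly the DOUBLE UNIFORMITY: (i) in the depth `j → ∞` with one `c₀` — the renormalisation-group
content ([Balaban1985UV3] (71) integrated: NON-DECAY of the joint Peierls rate and NON-GROWTH of the transfer constant, here `D_j ∼ (151L²)^j`);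
(ii) in `γ → 0` at bounded depth — the fixed-lattice Laplace exponent (g2/g12), with no consumer on the route.  Planner note (as g4–g13, now
sharper): a crux typed `∀ γ ∈ (0, γ₁] ∀ j₀ ∃ (c₀, C₀)` would be CLOSED by this file; the honest crux is the `j`-uniform statement at FIXED
`γ`, and its bare and bounded-depth faces are no longer part of the obligation.

HONEST SCOPE.  Elementary (the N13 partition-function sandwich, convexity, the deterministic transfer); nothing of Bałaban's (41)/(47)/(71) is
asserted; the crux 25301 as typed, both stubs, `HistoryTailL` 19936 and every rung above stay OPEN; `YM3TorusSU2` (R3, RECORD rung, not Clay)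
is NOT proved; the Yang–Mills mass gap is NOT touched.

References: T. Bałaban, CMP **102** (1985) 255–275 [Balaban1985UV3] ((1)–(3) p.256, (7) p.257, (71) p.273); CMP **98** (1985) 17–51
[Balaban1985Averaging] (Prop. 1 (51) p.26); CMP **109** (1987) 249–301 [Balaban1987RG1] ((0.4) p.253, (0.14) p.254).
-/

noncomputable section

namespace Summit.QuantumFields.YangMills.Theorems.CoarseStiffnessTailBoundedDepthCompactCoupling

open MeasureTheory Finset
open Literature.MathematicalPhysics.QuantumFieldTheory
open Literature.MathematicalPhysics.QuantumFieldTheory.Balaban1983to89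
open Literature.MathematicalPhysics.QuantumFieldTheory.Balaban1983to89.BlockAveraging (blockAvg)
open Literature.MathematicalPhysics.QuantumFieldTheory.Balaban1983to89.ExpMeanLog (expMeanLogSU deltaSU deltaSU_pos)
open Literature.MathematicalPhysics.QuantumFieldTheory.Balaban1983to89.T3ContinuumYM3Torus
open Literature.MathematicalPhysics.QuantumFieldTheory.Balaban1983to89.T3UnitScaleTilt
open Literature.MathematicalPhysics.QuantumFieldTheory.Balaban1983to89.T3UnitLawDensityEML
open Literature.MathematicalPhysics.QuantumFieldTheory.Balaban1983to89.T4PairDerivBridge (dist1_le_two_specialUnitaryGroup)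
open Summit.QuantumFields.YangMills.Theorems.CoarseStiffnessTailAveragedJointPeierls (card_pairs_three)
open Summit.QuantumFields.YangMills.Theorems.CoarseStiffnessTailEdgeBoundedDepth (beta_eq_pow_mul)
open Summit.QuantumFields.YangMills.Theorems.CoarseStiffnessTailPressureConvexity (sqSum_mem measurable_sqSum integrable_of_bounded)
open Summit.QuantumFields.YangMills.Theorems.CoarseStiffnessTailBareCompactCoupling (exists_bareStiffness_le slack_le)
open Summit.QuantumFields.YangMills.Theorems.LargeFieldMassRefinementTailSubGaussianRung (measurable_dist1_iter)
open Summit.QuantumFields.YangMills.Theorems.CoarseStiffnessTailQuadraticTransfer (sum_dist1_iter_sq_le)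

/-! ## §2 Bałaban's three-tori: the UNCAPPED stiffness of the `j`-fold averaged field is dominated by the bare one -/

section Coarse

variable (F : T3Family)

/-- The summed transfer on the three-tori (`d = 3`, `#pairs = 3`, `SU(2)`): for `j ≤ K`,
`Σ_a |Ū^j(∂a) − 1|² ≤ D_j²·3(2j+1)³·Σ_q |U(∂q) − 1|²` with `D_j` the §1 constant of `F.P K`. [cite: Balaban1985Averaging, Prop. 1 (51) p.26] -/
theorem sum_avg_sq_le (K j : ℕ) (hjK : j ≤ K) (U : GaugeField (F.P K) 0 (Matrix.specialUnitaryGroup (Fin 2) ℂ)) :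
    ∑ a : Plaq (F.P K) j, GaugeGroup.dist1 (GaugeField.plaqHol
        (Averaging.iter (fun i => blockAvg (P := F.P K) (j := i) ℰp) j U) a) ^ 2 ≤
      (max ((((F.P K).L : ℝ) ^ 2 + 6 * ((((F.P K).d + 2) * (F.P K).L : ℕ) : ℝ) ^ 2) ^ j)
          (4 * (((((F.P K).d + 2) * (F.P K).L : ℕ) : ℝ) ^ 2 / 4) *
            (((F.P K).L : ℝ) ^ 2 + 6 * ((((F.P K).d + 2) * (F.P K).L : ℕ) : ℝ) ^ 2) ^ (j - 1) / deltaSU (Fin 2))) ^ 2 *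
        ((3 * (2 * j + 1) ^ 3 : ℕ) : ℝ) * ∑ q : Plaq (F.P K) 0, GaugeGroup.dist1 (GaugeField.plaqHol U q) ^ 2 := by
  have hk : j ≤ (F.P K).m + (F.P K).K := by
    show j ≤ F.m + K
    omega
  have h := sum_dist1_iter_sq_le (P := F.P K) (n := Fin 2) hk U
  rw [card_pairs_three, show (F.P K).d = 3 from rfl] at h
  exact h

/-- `#Plaq_0 = L^{3j}·#Plaq_j` on the `K`-th approximation (`j ≤ K`; `2L^{m+K} = L^j·2L^{m+K−j}` sites per direction). [cite: Balaban1985UV3, (1)-(3) p.256] -/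
theorem card_plaq_zero_eq_pow_mul (K j : ℕ) (hjK : j ≤ K) :
    (Fintype.card (Plaq (F.P K) 0) : ℝ) = (F.L : ℝ) ^ (3 * j) * (Fintype.card (Plaq (F.P K) j) : ℝ) := by
  have h0 : (F.P K).sitesPerDir 0 = 2 * F.L ^ (F.m + K) := by
    simp [T3Family.P, Balaban1985CMP102.Setting.params3, Params.sitesPerDir]
  have hj : (F.P K).sitesPerDir j = 2 * F.L ^ (F.m + K - j) := by
    simp [T3Family.P, Balaban1985CMP102.Setting.params3, Params.sitesPerDir]
  rw [T4StabilityFloor.card_plaq, T4StabilityFloor.card_plaq, card_pairs_three, h0, hj, show (F.P K).d = 3 from rfl]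
  have hsplit : F.L ^ (F.m + K) = F.L ^ (F.m + K - j) * F.L ^ j := by
    rw [← pow_add]; congr 1; omega
  rw [hsplit]; push_cast; ring

/-- **★ THE UNCAPPED STIFFNESS OF THE AVERAGED FIELD WITH TOTAL LOGARITHMIC SLACK.**  For every block size `L` and depth `j` there are
`κ > 0` and `A ≥ 0` such that for every family `F` with `F.L = L`, every `0 < γ ≤ 1`, every cut-off `K ≥ j` and every `0 ≤ c₀ ≤ κ`:
`∫ exp(c₀·β_{K−j}·Σ_{a ∈ Plaq_j} |Ū^j(∂a) − 1|²) dGibbs_K ≤ exp(A·#Plaq_0 + (3/2)·(#Plaq_0/n_K)·log β_K)` (`β_{K−j} = (γL^{−(K−j)})⁻¹ = L^{−j}β_K`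
the crux's tilt strength at height `j`).  §2's transfer bounds the exponent pointwise by `(c₀D_j²·3(2j+1)³/L^j)·β_K·Σ_q|U(∂q) − 1|²`, and
`CoarseStiffnessTailBareCompactCoupling.exists_bareStiffness_le` integrates it. [folklore] -/
theorem exists_coarseStiffness_le (L j : ℕ) :
    ∃ κ A : ℝ, 0 < κ ∧ 0 ≤ A ∧ ∀ (F : T3Family), F.L = L → ∀ (γ : ℝ), 0 < γ → γ ≤ 1 → ∀ (K : ℕ), j ≤ K →
      ∀ (c₀ : ℝ), 0 ≤ c₀ → c₀ ≤ κ →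
      ∫ U, Real.exp (c₀ * (γ * ((F.L : ℝ)⁻¹) ^ (K - j))⁻¹ * ∑ a : Plaq (F.P K) j, GaugeGroup.dist1 (GaugeField.plaqHol
          (Averaging.iter (fun i => blockAvg (P := F.P K) (j := i) ℰp) j U) a) ^ 2) ∂(gibbsK F ℰp γ K) ≤
        Real.exp (A * (Fintype.card (Plaq (F.P K) 0) : ℝ) +
          3 / 2 * ((Fintype.card (Plaq (F.P K) 0) : ℝ) * ((F.P K).sitesPerDir 0 : ℝ)⁻¹) * Real.log (γ * ((F.L : ℝ)⁻¹) ^ K)⁻¹) := by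
  obtain ⟨A, hA0, hA⟩ := exists_bareStiffness_le
  -- the transfer constant, written with `L`
  set C₁ : ℝ := (L : ℝ) ^ 2 + 6 * (((3 + 2) * L : ℕ) : ℝ) ^ 2 with hC₁
  set D : ℝ := max (C₁ ^ j) (4 * ((((3 + 2) * L : ℕ) : ℝ) ^ 2 / 4) * C₁ ^ (j - 1) / deltaSU (Fin 2)) with hD
  set M : ℝ := ((3 * (2 * j + 1) ^ 3 : ℕ) : ℝ) with hM
  have hM0 : 0 < M := by rw [hM]; exact_mod_cast Nat.mul_pos (by norm_num) (pow_pos (by omega) 3)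
  have hDM1 : 0 < D ^ 2 * M + 1 := by positivity
  refine ⟨(8 * (D ^ 2 * M + 1))⁻¹, A, by positivity, hA0, fun F hFL γ hγ hγ1 K hjK c₀ hc₀ hc₀κ => ?_⟩
  subst hFL
  set βK : ℝ := (γ * ((F.L : ℝ)⁻¹) ^ K)⁻¹ with hβK
  set βKj : ℝ := (γ * ((F.L : ℝ)⁻¹) ^ (K - j))⁻¹ with hβKj
  have hL1 : (1 : ℝ) ≤ F.L := by exact_mod_cast F.hL.2.le
  have hLj : (1 : ℝ) ≤ (F.L : ℝ) ^ j := one_le_pow₀ hL1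
  have hβKj0 : 0 ≤ βKj := inv_nonneg.2 (mul_nonneg hγ.le (pow_nonneg (inv_nonneg.2 (Nat.cast_nonneg _)) _))
  have hscale : βK = (F.L : ℝ) ^ j * βKj := beta_eq_pow_mul F hjK
  haveI := isProbabilityMeasure_gibbsK F ℰp hγ.le K
  -- the fine coefficient `c' = c₀ D² M / L^j ≤ 1/8`
  set c' : ℝ := c₀ * (D ^ 2 * M) / (F.L : ℝ) ^ j with hc'
  have hc'0 : 0 ≤ c' := by rw [hc']; positivity
  have hc'8 : c' ≤ 1 / 8 := by
    rw [hc', div_le_iff₀ (by positivity)]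
    have h1 : c₀ * (D ^ 2 * M) ≤ (8 * (D ^ 2 * M + 1))⁻¹ * (D ^ 2 * M + 1) :=
      mul_le_mul hc₀κ (by linarith) (by positivity) (by positivity)
    have h2 : (8 * (D ^ 2 * M + 1))⁻¹ * (D ^ 2 * M + 1) = 1 / 8 := by
      field_simp
    rw [h2] at h1
    nlinarith
  have hfine := hA F γ hγ hγ1 K c' hc'0 hc'8
  -- pointwise domination of the exponents
  have hpt : ∀ U : GaugeField (F.P K) 0 (Matrix.specialUnitaryGroup (Fin 2) ℂ),
      c₀ * βKj * ∑ a : Plaq (F.P K) j, GaugeGroup.dist1 (GaugeField.plaqHol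
          (Averaging.iter (fun i => blockAvg (P := F.P K) (j := i) ℰp) j U) a) ^ 2 ≤
        c' * βK * ∑ q : Plaq (F.P K) 0, GaugeGroup.dist1 (GaugeField.plaqHol U q) ^ 2 := fun U => by
    have ht := sum_avg_sq_le F K j hjK U
    have hd : (F.P K).d = 3 := rfl
    have hL : (F.P K).L = F.L := rfl
    simp only [hd, hL] at ht
    have hS0 : 0 ≤ ∑ q : Plaq (F.P K) 0, GaugeGroup.dist1 (GaugeField.plaqHol U q) ^ 2 := sum_nonneg fun q _ => sq_nonneg _
    calc c₀ * βKj * ∑ a : Plaq (F.P K) j, GaugeGroup.dist1 (GaugeField.plaqHol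
            (Averaging.iter (fun i => blockAvg (P := F.P K) (j := i) ℰp) j U) a) ^ 2
        ≤ c₀ * βKj * (D ^ 2 * M * ∑ q : Plaq (F.P K) 0, GaugeGroup.dist1 (GaugeField.plaqHol U q) ^ 2) :=
          mul_le_mul_of_nonneg_left ht (mul_nonneg hc₀ hβKj0)
      _ = c' * βK * ∑ q : Plaq (F.P K) 0, GaugeGroup.dist1 (GaugeField.plaqHol U q) ^ 2 := by
          rw [hscale, hc']; field_simp
  -- integrate
  refine le_trans (integral_mono_of_nonneg (ae_of_all _ fun U => (Real.exp_pos _).le) ?_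
    (ae_of_all _ fun U => Real.exp_le_exp.mpr (hpt U))) hfine
  refine integrable_of_bounded (((measurable_sqSum F K).const_mul _).exp)
    (M := Real.exp (c' * βK * (4 * (Fintype.card (Plaq (F.P K) 0) : ℝ)))) fun U => ?_
  rw [abs_of_pos (Real.exp_pos _)]
  have hβK0 : 0 ≤ βK := by rw [hscale]; positivity
  exact Real.exp_le_exp.mpr (mul_le_mul_of_nonneg_left (sqSum_mem F U).2 (by positivity))

end Coarse

/-! ## §3 THE CRUX AT EVERY BOUNDED DEPTH ON EVERY COMPACT COUPLING RANGE, uniformly in the cut-off and the volume -/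

section BoundedDepth

/-- **★★ THE UNCAPPED COARSE STIFFNESS AT BOUNDED DEPTH ON COMPACT COUPLING RANGES.**  For every `L`, `j₀` and `γ_lo > 0` there are
`c₀ > 0`, `C₀` such that for every family `F` with `F.L = L`, every `γ ∈ [γ_lo, 1]`, every cut-off `K` and every depth `j ≤ min(j₀, K)`:
`∫ exp(c₀·β_{K−j}·Σ_{a ∈ Plaq_j} |Ū^j(∂a) − 1|²) dGibbs_K ≤ exp(C₀·#Plaq_j)` (`#Plaq_0 = L^{3j}#Plaq_j`, and the slack is `O(#Plaq_0)` on
`[γ_lo, 1]` by `CoarseStiffnessTailBareCompactCoupling.slack_le`). [folklore] -/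
theorem coarseStiffness_boundedDepth_compactCoupling (L j₀ : ℕ) (γlo : ℝ) (hγlo : 0 < γlo) :
    ∃ (c₀ C₀ : ℝ), 0 < c₀ ∧ ∀ (F : T3Family), F.L = L → ∀ (γ : ℝ), γlo ≤ γ → γ ≤ 1 → ∀ (K j : ℕ), j ≤ j₀ → j ≤ K →
      ∫ U, Real.exp (c₀ * (γ * ((F.L : ℝ)⁻¹) ^ (K - j))⁻¹ * ∑ a : Plaq (F.P K) j, GaugeGroup.dist1 (GaugeField.plaqHol
          (Averaging.iter (fun i => blockAvg (P := F.P K) (j := i) ℰp) j U) a) ^ 2) ∂(gibbsK F ℰp γ K) ≤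
        Real.exp (C₀ * (Fintype.card (Plaq (F.P K) j) : ℝ)) := by
  choose κ A hκ0 hA0 hκ using fun j => exists_coarseStiffness_le L j
  have hne : (range (j₀ + 1)).Nonempty := ⟨0, by simp⟩
  set c₀ : ℝ := (range (j₀ + 1)).inf' hne κ with hc₀
  set A₀ : ℝ := (range (j₀ + 1)).sup' hne A with hA₀
  have hc₀0 : 0 < c₀ := by rw [hc₀]; exact (Finset.lt_inf'_iff hne).2 fun j _ => hκ0 j
  have hA₀0 : 0 ≤ A₀ := by rw [hA₀]; exact le_trans (hA0 0) (Finset.le_sup' A (by simp))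
  refine ⟨c₀, (A₀ + 3 / 4 * (1 + max (Real.log γlo⁻¹) 0)) * (L : ℝ) ^ (3 * j₀), hc₀0,
    fun F hFL γ hle hγ1 K j hj hjK => ?_⟩
  have hγ : 0 < γ := lt_of_lt_of_le hγlo hle
  have hjmem : j ∈ range (j₀ + 1) := mem_range.2 (by omega)
  have hcκ : c₀ ≤ κ j := by rw [hc₀]; exact Finset.inf'_le κ hjmem
  have hAj : A j ≤ A₀ := by rw [hA₀]; exact Finset.le_sup' A hjmem
  refine (hκ j F hFL γ hγ hγ1 K hjK c₀ hc₀0.le hcκ).trans (Real.exp_le_exp.mpr ?_)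
  have hP0 : (0 : ℝ) ≤ (Fintype.card (Plaq (F.P K) 0) : ℝ) := Nat.cast_nonneg _
  have hPj : (0 : ℝ) ≤ (Fintype.card (Plaq (F.P K) j) : ℝ) := Nat.cast_nonneg _
  have hslack := slack_le F hγlo hle K (by norm_num : (0 : ℝ) ≤ 3 / 2)
  have hcard := card_plaq_zero_eq_pow_mul F K j hjK
  rw [hFL] at hcard
  have hL1 : (1 : ℝ) ≤ (L : ℝ) := by rw [← hFL]; exact_mod_cast F.hL.2.le
  have hpow : (L : ℝ) ^ (3 * j) ≤ (L : ℝ) ^ (3 * j₀) := pow_le_pow_right₀ hL1 (by omega)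
  have hM0 : 0 ≤ 3 / 4 * (1 + max (Real.log γlo⁻¹) 0) := by positivity
  calc A j * (Fintype.card (Plaq (F.P K) 0) : ℝ) +
        3 / 2 * ((Fintype.card (Plaq (F.P K) 0) : ℝ) * ((F.P K).sitesPerDir 0 : ℝ)⁻¹) * Real.log (γ * ((F.L : ℝ)⁻¹) ^ K)⁻¹
      ≤ A₀ * (Fintype.card (Plaq (F.P K) 0) : ℝ) + 3 / 2 / 2 * (1 + max (Real.log γlo⁻¹) 0) * (Fintype.card (Plaq (F.P K) 0) : ℝ) := by
        nlinarith
    _ = (A₀ + 3 / 4 * (1 + max (Real.log γlo⁻¹) 0)) * ((L : ℝ) ^ (3 * j) * (Fintype.card (Plaq (F.P K) j) : ℝ)) := by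
        rw [hcard]; ring
    _ ≤ (A₀ + 3 / 4 * (1 + max (Real.log γlo⁻¹) 0)) * ((L : ℝ) ^ (3 * j₀) * (Fintype.card (Plaq (F.P K) j) : ℝ)) :=
        mul_le_mul_of_nonneg_left (mul_le_mul_of_nonneg_right hpow hPj) (by positivity)
    _ = (A₀ + 3 / 4 * (1 + max (Real.log γlo⁻¹) 0)) * (L : ℝ) ^ (3 * j₀) * (Fintype.card (Plaq (F.P K) j) : ℝ) := by ring

variable (F : T3Family)

/-- DOMINATION at height `j`: a per-plaquette integrand `g_a(U) ≤ |Ū^j(∂a) − 1|²` inherits any bound of the uncapped coarse moment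
(the uncapped integrand is bounded, so integrability never fails). [folklore] -/
theorem integral_exp_avg_dominated_le {γ : ℝ} (hγ : 0 < γ) (K j : ℕ) {c : ℝ} (hc : 0 ≤ c)
    (g : Plaq (F.P K) j → GaugeField (F.P K) 0 (Matrix.specialUnitaryGroup (Fin 2) ℂ) → ℝ)
    (hg : ∀ a U, g a U ≤ GaugeGroup.dist1 (GaugeField.plaqHol (Averaging.iter (fun i => blockAvg (P := F.P K) (j := i) ℰp) j U) a) ^ 2)
    {B : ℝ} (hB : ∫ U, Real.exp (c * ∑ a : Plaq (F.P K) j, GaugeGroup.dist1 (GaugeField.plaqHol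
          (Averaging.iter (fun i => blockAvg (P := F.P K) (j := i) ℰp) j U) a) ^ 2) ∂(gibbsK F ℰp γ K) ≤ B) :
    ∫ U, Real.exp (c * ∑ a : Plaq (F.P K) j, g a U) ∂(gibbsK F ℰp γ K) ≤ B := by
  haveI := isProbabilityMeasure_gibbsK F ℰp hγ.le K
  refine le_trans (integral_mono_of_nonneg (ae_of_all _ fun U => (Real.exp_pos _).le) ?_
    (ae_of_all _ fun U => Real.exp_le_exp.mpr (mul_le_mul_of_nonneg_left (sum_le_sum fun a _ => hg a U) hc))) hB
  refine integrable_of_bounded (Measurable.const_mul (Finset.measurable_sum _ fun a _ => (measurable_dist1_iter F K j a).pow_const 2) _).exp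
    (M := Real.exp (c * (4 * (Fintype.card (Plaq (F.P K) j) : ℝ)))) fun U => ?_
  rw [abs_of_pos (Real.exp_pos _)]
  refine Real.exp_le_exp.mpr (mul_le_mul_of_nonneg_left ?_ hc)
  calc ∑ a : Plaq (F.P K) j, GaugeGroup.dist1 (GaugeField.plaqHol
          (Averaging.iter (fun i => blockAvg (P := F.P K) (j := i) ℰp) j U) a) ^ 2
      ≤ ∑ _a : Plaq (F.P K) j, (4 : ℝ) := sum_le_sum fun a _ => by
        have h2 := dist1_le_two_specialUnitaryGroup (GaugeField.plaqHol
          (Averaging.iter (fun i => blockAvg (P := F.P K) (j := i) ℰp) j U) a)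
        have h0 := GaugeGroup.dist1_nonneg (GaugeField.plaqHol
          (Averaging.iter (fun i => blockAvg (P := F.P K) (j := i) ℰp) j U) a)
        nlinarith
    _ = 4 * (Fintype.card (Plaq (F.P K) j) : ℝ) := by rw [sum_const, card_univ, nsmul_eq_mul, mul_comm]

/-- **★★★ THE CRUX AT EVERY BOUNDED DEPTH ON EVERY COMPACT COUPLING RANGE.**  For every block size `L`, depth bound `j₀` and `γ_lo > 0`
there are `c₀ > 0` and `C₀` such that for EVERY three-torus family `F` with `F.L = L` (any volume exponent `m`), every `γ ∈ [γ_lo, 1]`,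
every profile `(b₀, p₀)`, EVERY cut-off `K` and every height `j ≤ min(j₀, K)`:

  `∫ exp(c₀·(γL^{−(K−j)})⁻¹·Σ_{a ∈ Plaq_j} min(|Ū^j(∂a) − 1|², θ(K−j)²)) dGibbs_K ≤ exp(C₀·#Plaq_j)`

— the statement of `CappedCoarseStiffnessL` (stmt-QuantumFields-25301) with `j ≤ j₀` and `γ_lo ≤ γ` added (its integrand verbatim).  The
located content of the crux is therefore EXACTLY the double uniformity `j → ∞` (with `K`) and `γ → 0`: the first is the renormalisation-group
content (g13: non-decay of the joint Peierls rate in the depth, [Balaban1985UV3] (71)); the second, at bounded depth, is the fixed-lattice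
Laplace exponent (g2/g12), read by no consumer. [folklore] -/
theorem crux_boundedDepth_compactCoupling (L j₀ : ℕ) (γlo : ℝ) (hγlo : 0 < γlo) :
    ∃ (c₀ C₀ : ℝ), 0 < c₀ ∧ ∀ (F : T3Family), F.L = L → ∀ (γ b₀ p₀ : ℝ), γlo ≤ γ → γ ≤ 1 → ∀ (K j : ℕ), j ≤ j₀ → j ≤ K →
      ∫ U, Real.exp (c₀ * (γ * ((F.L : ℝ)⁻¹) ^ (K - j))⁻¹ *
          ∑ a : Plaq (F.P K) j, min (GaugeGroup.dist1 (GaugeField.plaqHol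
            (Averaging.iter (fun i => BlockAveraging.blockAvg (P := F.P K) (j := i) T3UnitLawDensityEML.ℰp) j U) a) ^ 2)
            (T3UnitScaleTilt.θBal F.L γ b₀ p₀ (K - j) ^ 2)) ∂(T3UnitScaleTilt.gibbsK F T3UnitLawDensityEML.ℰp γ K) ≤
        Real.exp (C₀ * (Fintype.card (Plaq (F.P K) j) : ℝ)) := by
  obtain ⟨c₀, C₀, hc₀, h⟩ := coarseStiffness_boundedDepth_compactCoupling L j₀ γlo hγlo
  refine ⟨c₀, C₀, hc₀, fun F hFL γ b₀ p₀ hle hγ1 K j hj hjK => ?_⟩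
  have hγ : 0 < γ := lt_of_lt_of_le hγlo hle
  have hc : 0 ≤ c₀ * (γ * ((F.L : ℝ)⁻¹) ^ (K - j))⁻¹ :=
    mul_nonneg hc₀.le (inv_nonneg.2 (mul_nonneg hγ.le (pow_nonneg (inv_nonneg.2 (Nat.cast_nonneg _)) _)))
  have hd := integral_exp_avg_dominated_le F hγ K j hc
    (fun a U => min (GaugeGroup.dist1 (GaugeField.plaqHol
      (Averaging.iter (fun i => BlockAveraging.blockAvg (P := F.P K) (j := i) T3UnitLawDensityEML.ℰp) j U) a) ^ 2)
      (T3UnitScaleTilt.θBal F.L γ b₀ p₀ (K - j) ^ 2))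
    (fun a U => min_le_left _ _) (h F hFL γ hle hγ1 K j hj hjK)
  simpa only [mul_assoc] using hd

/-- **★★★ THE BULK STUB AT EVERY BOUNDED DEPTH ON EVERY COMPACT COUPLING RANGE**: the registered `stub_subThresholdStiffness` of skeleton v5
with `j ≤ j₀` and `γ_lo ≤ γ` added (integrand verbatim), constants depending on `(L, j₀, γ_lo)`. [folklore] -/
theorem bulk_boundedDepth_compactCoupling (L j₀ : ℕ) (γlo : ℝ) (hγlo : 0 < γlo) :
    ∃ (c₀ C₀ : ℝ), 0 < c₀ ∧ ∀ (F : T3Family), F.L = L → ∀ (γ b₀ p₀ : ℝ), γlo ≤ γ → γ ≤ 1 → ∀ (K j : ℕ), j ≤ j₀ → j ≤ K →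
      ∫ U, Real.exp (c₀ * (γ * ((F.L : ℝ)⁻¹) ^ (K - j))⁻¹ *
          ∑ a : Plaq (F.P K) j, (if GaugeGroup.dist1 (GaugeField.plaqHol
              (Averaging.iter (fun i => BlockAveraging.blockAvg (P := F.P K) (j := i) T3UnitLawDensityEML.ℰp) j U) a) <
              T3UnitScaleTilt.θBal F.L γ b₀ p₀ (K - j) then GaugeGroup.dist1 (GaugeField.plaqHol
              (Averaging.iter (fun i => BlockAveraging.blockAvg (P := F.P K) (j := i) T3UnitLawDensityEML.ℰp) j U) a) ^ 2 else 0))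
          ∂(T3UnitScaleTilt.gibbsK F T3UnitLawDensityEML.ℰp γ K) ≤
        Real.exp (C₀ * (Fintype.card (Plaq (F.P K) j) : ℝ)) := by
  obtain ⟨c₀, C₀, hc₀, h⟩ := coarseStiffness_boundedDepth_compactCoupling L j₀ γlo hγlo
  refine ⟨c₀, C₀, hc₀, fun F hFL γ b₀ p₀ hle hγ1 K j hj hjK => ?_⟩
  have hγ : 0 < γ := lt_of_lt_of_le hγlo hle
  have hc : 0 ≤ c₀ * (γ * ((F.L : ℝ)⁻¹) ^ (K - j))⁻¹ :=
    mul_nonneg hc₀.le (inv_nonneg.2 (mul_nonneg hγ.le (pow_nonneg (inv_nonneg.2 (Nat.cast_nonneg _)) _)))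
  have hd := integral_exp_avg_dominated_le F hγ K j hc
    (fun a U => if GaugeGroup.dist1 (GaugeField.plaqHol
        (Averaging.iter (fun i => BlockAveraging.blockAvg (P := F.P K) (j := i) T3UnitLawDensityEML.ℰp) j U) a) <
        T3UnitScaleTilt.θBal F.L γ b₀ p₀ (K - j) then GaugeGroup.dist1 (GaugeField.plaqHol
        (Averaging.iter (fun i => BlockAveraging.blockAvg (P := F.P K) (j := i) T3UnitLawDensityEML.ℰp) j U) a) ^ 2 else 0)
    (fun a U => by
      show (if _ then _ else _) ≤ _
      split_ifs
      · exact le_rfl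
      · exact sq_nonneg _)
    (h F hFL γ hle hγ1 K j hj hjK)
  simpa only [mul_assoc] using hd

end BoundedDepth

/-! ## §4 THE CRUX REDUCES TO ITS DEEP-OR-SUPERWEAK TAIL -/

section Tail

variable (F : T3Family)

/-- Monotonicity of the capped moment in the tilt strength: `0 ≤ c ≤ c'` ⇒ `∫exp(c·S) ≤ ∫exp(c'·S)` for the (non-negative, bounded) capped
sum `S = Σ_a min(|Ū^j(∂a) − 1|², θ²)`. [folklore] -/
theorem integral_exp_capped_mono {γ : ℝ} (hγ : 0 < γ) (K j : ℕ) (θ : ℝ) {c c' : ℝ} (hc : 0 ≤ c) (hcc' : c ≤ c') :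
    ∫ U, Real.exp (c * ∑ a : Plaq (F.P K) j, min (GaugeGroup.dist1 (GaugeField.plaqHol
        (Averaging.iter (fun i => blockAvg (P := F.P K) (j := i) ℰp) j U) a) ^ 2) (θ ^ 2)) ∂(gibbsK F ℰp γ K) ≤
      ∫ U, Real.exp (c' * ∑ a : Plaq (F.P K) j, min (GaugeGroup.dist1 (GaugeField.plaqHol
        (Averaging.iter (fun i => blockAvg (P := F.P K) (j := i) ℰp) j U) a) ^ 2) (θ ^ 2)) ∂(gibbsK F ℰp γ K) := by
  haveI := isProbabilityMeasure_gibbsK F ℰp hγ.le K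
  have hS : ∀ U : GaugeField (F.P K) 0 (Matrix.specialUnitaryGroup (Fin 2) ℂ),
      0 ≤ ∑ a : Plaq (F.P K) j, min (GaugeGroup.dist1 (GaugeField.plaqHol
        (Averaging.iter (fun i => blockAvg (P := F.P K) (j := i) ℰp) j U) a) ^ 2) (θ ^ 2) ∧
      ∑ a : Plaq (F.P K) j, min (GaugeGroup.dist1 (GaugeField.plaqHol
        (Averaging.iter (fun i => blockAvg (P := F.P K) (j := i) ℰp) j U) a) ^ 2) (θ ^ 2) ≤ 4 * (Fintype.card (Plaq (F.P K) j) : ℝ) :=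
    fun U => by
    refine ⟨sum_nonneg fun a _ => le_min (sq_nonneg _) (sq_nonneg _), ?_⟩
    calc ∑ a : Plaq (F.P K) j, min (GaugeGroup.dist1 (GaugeField.plaqHol
            (Averaging.iter (fun i => blockAvg (P := F.P K) (j := i) ℰp) j U) a) ^ 2) (θ ^ 2)
        ≤ ∑ _a : Plaq (F.P K) j, (4 : ℝ) := sum_le_sum fun a _ => (min_le_left _ _).trans (by
          have h2 := dist1_le_two_specialUnitaryGroup (GaugeField.plaqHol
            (Averaging.iter (fun i => blockAvg (P := F.P K) (j := i) ℰp) j U) a)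
          have h0 := GaugeGroup.dist1_nonneg (GaugeField.plaqHol
            (Averaging.iter (fun i => blockAvg (P := F.P K) (j := i) ℰp) j U) a)
          nlinarith)
      _ = 4 * (Fintype.card (Plaq (F.P K) j) : ℝ) := by rw [sum_const, card_univ, nsmul_eq_mul, mul_comm]
  refine integral_mono_of_nonneg (ae_of_all _ fun U => (Real.exp_pos _).le) ?_
    (ae_of_all _ fun U => Real.exp_le_exp.mpr (mul_le_mul_of_nonneg_right hcc' (hS U).1))
  refine integrable_of_bounded (Measurable.const_mul (Finset.measurable_sum _ fun a _ =>
      ((measurable_dist1_iter F K j a).pow_const 2).min measurable_const) _).exp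
    (M := Real.exp (c' * (4 * (Fintype.card (Plaq (F.P K) j) : ℝ)))) fun U => ?_
  rw [abs_of_pos (Real.exp_pos _)]
  exact Real.exp_le_exp.mpr (mul_le_mul_of_nonneg_left (hS U).2 (hc.trans hcc'))

/-- **★★★ THE CRUX REDUCES TO ITS DEEP-OR-SUPERWEAK TAIL.**  `CappedCoarseStiffnessL` (stmt-QuantumFields-25301) FOLLOWS from its restriction to
the heights `j > j₀` OR couplings `γ < γ_lo`, for ANY choice of `j₀` and `γ_lo > 0` (allowed to depend on `L, b₀, p₀`): the complementary
instances `j ≤ j₀ ∧ γ_lo ≤ γ` are §3's theorem, and the constants merge by `min`/`max`.  (The converse is trivial.)  This is the located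
content of the crux in the kernel's letters. [folklore] -/
theorem cappedCoarseStiffnessL_of_deepTail
    (h : ∀ (L : ℕ) (b₀ p₀ : ℝ), 0 < b₀ → 2 < p₀ → ∃ (j₀ : ℕ) (γlo c₀ C₀ γ₁ : ℝ), 0 < γlo ∧ 0 < c₀ ∧ 0 < γ₁ ∧ γ₁ ≤ 1 ∧
      ∀ (F : T3Family) (γ : ℝ), F.L = L → 0 < γ → γ ≤ γ₁ → ∀ (K j : ℕ), j ≤ K → (j₀ < j ∨ γ < γlo) →
        ∫ U, Real.exp (c₀ * (γ * ((F.L : ℝ)⁻¹) ^ (K - j))⁻¹ *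
            ∑ a : Plaq (F.P K) j, min (GaugeGroup.dist1 (GaugeField.plaqHol
              (Averaging.iter (fun i => BlockAveraging.blockAvg (P := F.P K) (j := i) T3UnitLawDensityEML.ℰp) j U) a) ^ 2)
              (T3UnitScaleTilt.θBal F.L γ b₀ p₀ (K - j) ^ 2)) ∂(T3UnitScaleTilt.gibbsK F T3UnitLawDensityEML.ℰp γ K) ≤
          Real.exp (C₀ * (Fintype.card (Plaq (F.P K) j) : ℝ))) :
    Summit.QuantumFields.YangMills.Theses.CoarseStiffnessTail.CappedCoarseStiffnessL := by
  intro L b₀ p₀ hb₀ hp₀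
  obtain ⟨j₀, γlo, c₁, C₁, γ₁, hγlo, hc₁, hγ₁, hγ₁1, hT⟩ := h L b₀ p₀ hb₀ hp₀
  obtain ⟨c₂, C₂, hc₂, hB⟩ := crux_boundedDepth_compactCoupling L j₀ γlo hγlo
  refine ⟨min c₁ c₂, max C₁ C₂, γ₁, lt_min hc₁ hc₂, hγ₁, hγ₁1, fun F γ hFL hγ hγle K j hjK => ?_⟩
  have hmin0 : 0 ≤ min c₁ c₂ := (lt_min hc₁ hc₂).le
  have hβ0 : 0 ≤ (γ * ((F.L : ℝ)⁻¹) ^ (K - j))⁻¹ := inv_nonneg.2 (mul_nonneg hγ.le (pow_nonneg (inv_nonneg.2 (Nat.cast_nonneg _)) _))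
  have hPj : (0 : ℝ) ≤ (Fintype.card (Plaq (F.P K) j) : ℝ) := Nat.cast_nonneg _
  have hmono : ∀ {c : ℝ}, min c₁ c₂ ≤ c →
      ∫ U, Real.exp (min c₁ c₂ * (γ * ((F.L : ℝ)⁻¹) ^ (K - j))⁻¹ *
          ∑ a : Plaq (F.P K) j, min (GaugeGroup.dist1 (GaugeField.plaqHol
            (Averaging.iter (fun i => BlockAveraging.blockAvg (P := F.P K) (j := i) T3UnitLawDensityEML.ℰp) j U) a) ^ 2)
            (T3UnitScaleTilt.θBal F.L γ b₀ p₀ (K - j) ^ 2)) ∂(T3UnitScaleTilt.gibbsK F T3UnitLawDensityEML.ℰp γ K) ≤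
        ∫ U, Real.exp (c * (γ * ((F.L : ℝ)⁻¹) ^ (K - j))⁻¹ *
          ∑ a : Plaq (F.P K) j, min (GaugeGroup.dist1 (GaugeField.plaqHol
            (Averaging.iter (fun i => BlockAveraging.blockAvg (P := F.P K) (j := i) T3UnitLawDensityEML.ℰp) j U) a) ^ 2)
            (T3UnitScaleTilt.θBal F.L γ b₀ p₀ (K - j) ^ 2)) ∂(T3UnitScaleTilt.gibbsK F T3UnitLawDensityEML.ℰp γ K) :=
    fun {c} hc => by
    have h1 := integral_exp_capped_mono F hγ K j (T3UnitScaleTilt.θBal F.L γ b₀ p₀ (K - j)) (mul_nonneg hmin0 hβ0)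
      (mul_le_mul_of_nonneg_right hc hβ0)
    simpa only [mul_assoc] using h1
  by_cases htail : j₀ < j ∨ γ < γlo
  · exact ((hmono (min_le_left _ _)).trans (hT F γ hFL hγ hγle K j hjK htail)).trans
      (Real.exp_le_exp.mpr (mul_le_mul_of_nonneg_right (le_max_left _ _) hPj))
  · push Not at htail
    exact ((hmono (min_le_right _ _)).trans (hB F hFL γ b₀ p₀ htail.2 (hγle.trans hγ₁1) K j htail.1 hjK)).trans
      (Real.exp_le_exp.mpr (mul_le_mul_of_nonneg_right (le_max_right _ _) hPj))

end Tail

end Summit.QuantumFields.YangMills.Theorems.CoarseStiffnessTailBoundedDepthCompactCoupling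

end
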